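/-
Copyright (c) 2026 the pub-hodgecm-mathlib formalisation cell (harness21).  Prover seat hodgecm-mathlib-K2E3-p25 (g2), HCML Track B «K2-LIT»,
h413 = `stmt-HodgeConjecture-24833`, road (11-3-split-nsc), leaf (nsc-S-A′) `sig_K2E3GL3PrincipalBlockStandardSpan` (U12 :463), brick PEEL (file 2 of 3) of the leaf
owner's `K2/K2E3-p25/g2/MEMO-SA-architecture.v2.K2E3-p25-g2.md` §2 (feed (B) of H0).  2026-09-04.
-/
import Summits.HodgeConjecture.HodgeConjecture.Theorems.K2E3GL2JacquetProdRep   -- ★ PEEL file 1: `exists_prodRep`, `prodRep_apply_mk`, `exact_of_mk_comp`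
import HarnessLib

/-!
# K2_E3 road (h413), leaf (nsc-S-A′), brick PEEL (file 2 of 3) — THE FROBENIUS PEELING STEP for the Jacquet exponents of a `GL₂(F)`-representation with a commuting
# action (no composition series, no finite length)

Cell `pub/hodgecm-mathlib` (D-0151), Track B, seat K2E3-p25 (g2) (leaf owner ∕ architect).  `--supports stmt-HodgeConjecture-24833 --as helper`; THEOREMS ONLY
(no `def`, no instance, no notation, no `sorry`); never imports `Cruxes/…/Lines`.  COUNT-NEUTRAL.  Setting and currency: file 1 (`K2E3GL2JacquetProdRep`); weights of the
`T₂ × D`-module `τ` are indexed by functions on `T₂ × D`, and for `χ = x ⊠ y`, `ξ : D → ℂ` the weight `χ ⊗ ξ := fun p => χ p.1 * ξ p.2` is spelled inline;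
`mult τ η := finrank ℂ ↥(⨅ p, maxGenEigenspace (τ p) (η p))`.

THE RESULT **`exists_peel`**: if `C(X)` is finite-dimensional, the weight `(x ⊠ y) ⊗ ξ` OCCURS and `I₂ x y` is irreducible, there is a `W`- and `ζ`-stable `K ≤ X` with
`finrank C(K) < finrank C(X)` and `mult_X ((x⊠y)⊗ξ) = mult_K ((x⊠y)⊗ξ) + c`, `mult_X ((y⊠x)⊗ξ) = mult_K ((y⊠x)⊗ξ) + c`, `c = mult_{I₂ x y} (x ⊠ y)` (`= 1 + [x = y]`, ★ G1 (a)).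
Proof: a non-zero `T₂ × D`-eigenfunctional on the weight space (★ E1b) is a `T₂`-map `r(W) → x ⊠ y`, hence (★ Frobenius `Representation.frobeniusInv` + ★
`apply_mk_apply_of_intertwining`) a NON-ZERO `G₂`-map `Φ : W → I₂ x y`, SURJECTIVE by irreducibility, with `Φ ∘ ζ(d) = ξ(d) • Φ` (so `ξ` is a character); `K = ker Φ`; Jacquet
exactness of `0 → K → X → I₂ x y → 0` (★ left exactness `jacquetMap_injective` via ★ G1 `exists_jacquetLinearMap`, right exactness ★ file 1) and ★ E1a additivity for the three
`T₂ × D`-modules (`τ_K` from ★ file 1 `exists_prodRep`, `ξ(d) • r(t)` on `C(I₂ x y)`).  [BernsteinZelevinsky1977, Prop. 1.9, §2.3, Cor. 2.13, Thm. 2.5, Thm. 5.2; Casselman1995,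
Thm. 3.2.4, §6.3, Lemma 7.1.1]  PERF NOTE (shared with K2E3-p14 (g7)'s ★ BRIDGE): on goals containing `normalizedJacquetGL … [v]`-terms never `rw` with generic lemmas
(`map_smul`, `MonoidHom.comp_apply`, …) or `obtain ⟨_, rfl⟩` — `kabstract` then unifies by unfolding the Jacquet functor; use `Eq.trans`∕`congrArg`, `Coinvariants.induction_on`,
specific lemma instances, `simp only`, and `have … := …; obtain … := this`; the one long proof below runs on a raised (cumulative) heartbeat budget for that reason only.

HONEST LABEL: HC_CM is proved only modulo the 7 printed citations (2 remaining named inputs: hLiu418 = stmt-HodgeConjecture-24832, h413 = stmt-HodgeConjecture-24833) until rung 0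
closes; count-neutral generic helper.

## References
* [BernsteinZelevinsky1977] I. N. Bernstein, A. V. Zelevinsky, *Induced representations of reductive p-adic groups I*, Ann. Sci. ÉNS 10 (1977), Prop. 1.9, §2.3, Cor. 2.13, Thm. 2.5, 5.2.
* [Casselman1995] W. Casselman, *Introduction to the theory of admissible representations of p-adic reductive groups* (draft 1 May 1995), Thm. 3.2.4, §4.4, §6.3, Lemma 7.1.1.
-/

set_option autoImplicit false
set_option linter.dupNamespace false

noncomputable section

open Module Module.End Function
open scoped MatrixGroups
open Literature.NumberTheory.Automorphic Literature.NumberTheory.Automorphic.Zelevinsky1980 ValuativeRel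
open Summit.HodgeConjecture.HodgeConjecture.Cruxes.H413.K2E3GL2JacquetModuleStructure
open Summit.HodgeConjecture.HodgeConjecture.Cruxes.H413.K2E3GL2JacquetExponents
open Summit.HodgeConjecture.HodgeConjecture.Cruxes.H413.K2E3JacquetExponentMultiset
open Summit.HodgeConjecture.HodgeConjecture.Cruxes.H413.K2E3JacquetExponentEigenvector
open Summit.HodgeConjecture.HodgeConjecture.Cruxes.H413.K2E3GL2JacquetProdRep

namespace Summit.HodgeConjecture.HodgeConjecture.Cruxes.H413.K2E3GL2JacquetPeelingStep

/-! ## §2 The peeling step -/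

section Peel

variable {F : Type} [Field F] [ValuativeRel F] [TopologicalSpace F] [IsNonarchimedeanLocalField F]
variable {D : Type} [Group D]
variable {X : Type} [AddCommGroup X] [Module ℂ X]

set_option maxHeartbeats 3200000 in  -- one long bookkeeping proof over large `normalizedJacquetGL` terms (cumulative budget, no single expensive step)
/-- **THE PEELING STEP.**  `W : GL₂(F) → GL(X)` smooth with finite-dimensional `U₂`-coinvariants, `ζ` a commuting `D`-action (`D` with commuting elements, `hD`), `τ` the
`T₂ × D`-action on the coinvariants (`hτ₁`, `hτ₂`); `x y` with open kernels, `ξ : D → ℂ`.  If the weight `(x ⊠ y) ⊗ ξ` OCCURS in `τ` and `I₂ x y` is irreducible, then there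
are a `W`- and `ζ`-stable `K ≤ X` (the kernel of the Frobenius map `Φ : X ↠ I₂ x y` attached to a `τ`-eigenfunctional, `Φ ∘ ζ(d) = ξ(d) Φ`), the restricted `D`-action `ζ_K` and
the `T₂ × D`-action `τ_K` on ITS coinvariants, with `W|_K` smooth, `C(K)` finite-dimensional of SMALLER dimension, and
**`mult τ ((x⊠y)⊗ξ) = mult τ_K ((x⊠y)⊗ξ) + mult (I₂ x y) (x⊠y)`, `mult τ ((y⊠x)⊗ξ) = mult τ_K ((y⊠x)⊗ξ) + mult (I₂ x y) (x⊠y)`** (★ E1a additivity along the Jacquet-exact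
`0 → C(K) → C(X) → C(I₂ x y) → 0`; the last term is `1 + [x = y]` by ★ G1 (a)). [cite: BernsteinZelevinsky1977, Prop. 1.9 (b), Cor. 2.13, Thm. 2.5] [cite: Casselman1995, Thm. 3.2.4, §6.3] -/
theorem exists_peel (hD : ∀ d d' : D, d * d' = d' * d)
    (W : Representation ℂ (GL (Fin 2) F) X) (hW : W.IsSmooth) (ζ : Representation ℂ D X) (hWζ : ∀ g d, W g * ζ d = ζ d * W g)
    (τ : Representation ℂ ((Π a : Bool, GL {i : Fin 2 // lastBlockLabel 2 i = a} F) × D) (Representation.restrictUnipotentGL F (lastBlockLabel 2) W).Coinvariants)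
    (hτ₁ : ∀ t, τ (t, 1) = Representation.normalizedJacquetGL F (lastBlockLabel 2) W t)
    (hτ₂ : ∀ d v, τ (1, d) (Representation.Coinvariants.mk _ v) = Representation.Coinvariants.mk _ (ζ d v))
    [FiniteDimensional ℂ (Representation.restrictUnipotentGL F (lastBlockLabel 2) W).Coinvariants]
    (x y : Fˣ →* ℂˣ) (hx : IsOpen (x.ker : Set Fˣ)) (hy : IsOpen (y.ker : Set Fˣ))
    (hirr : (Representation.parabolicIndGL F (lastBlockLabel 2)
      ((Representation.trivial ℂ (Π a : Bool, GL {i : Fin 2 // lastBlockLabel 2 i = a} F) ℂ).twist (maxParabolicLeviChar F 2 x y))).IsIrreducible)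
    (ξ : D → ℂ)
    (hne : (⨅ p, Module.End.maxGenEigenspace (τ p) (((maxParabolicLeviChar F 2 x y p.1 : ℂˣ) : ℂ) * ξ p.2)) ≠ ⊥) :
    ∃ (K : Subrepresentation W) (ζK : Representation ℂ D K.toSubmodule)
      (τK : Representation ℂ ((Π a : Bool, GL {i : Fin 2 // lastBlockLabel 2 i = a} F) × D) (Representation.restrictUnipotentGL F (lastBlockLabel 2) K.toRepresentation).Coinvariants),
      (∀ d (v : K.toSubmodule), ((ζK d v : K.toSubmodule) : X) = ζ d (v : X)) ∧
      (∀ g d, K.toRepresentation g * ζK d = ζK d * K.toRepresentation g) ∧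
      K.toRepresentation.IsSmooth ∧
      (∀ t, τK (t, 1) = Representation.normalizedJacquetGL F (lastBlockLabel 2) K.toRepresentation t) ∧
      (∀ d v, τK (1, d) (Representation.Coinvariants.mk _ v) = Representation.Coinvariants.mk _ (ζK d v)) ∧
      FiniteDimensional ℂ (Representation.restrictUnipotentGL F (lastBlockLabel 2) K.toRepresentation).Coinvariants ∧
      finrank ℂ (Representation.restrictUnipotentGL F (lastBlockLabel 2) K.toRepresentation).Coinvariants <
        finrank ℂ (Representation.restrictUnipotentGL F (lastBlockLabel 2) W).Coinvariants ∧
      finrank ℂ ↥(⨅ p, Module.End.maxGenEigenspace (τ p) (((maxParabolicLeviChar F 2 x y p.1 : ℂˣ) : ℂ) * ξ p.2)) =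
        finrank ℂ ↥(⨅ p, Module.End.maxGenEigenspace (τK p) (((maxParabolicLeviChar F 2 x y p.1 : ℂˣ) : ℂ) * ξ p.2)) +
          finrank ℂ ↥(⨅ m, Module.End.maxGenEigenspace
            (Representation.normalizedJacquetGL F (lastBlockLabel 2) (Representation.parabolicIndGL F (lastBlockLabel 2)
              ((Representation.trivial ℂ (Π a : Bool, GL {i : Fin 2 // lastBlockLabel 2 i = a} F) ℂ).twist (maxParabolicLeviChar F 2 x y))) m)
            ((maxParabolicLeviChar F 2 x y m : ℂˣ) : ℂ)) ∧
      finrank ℂ ↥(⨅ p, Module.End.maxGenEigenspace (τ p) (((maxParabolicLeviChar F 2 y x p.1 : ℂˣ) : ℂ) * ξ p.2)) =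
        finrank ℂ ↥(⨅ p, Module.End.maxGenEigenspace (τK p) (((maxParabolicLeviChar F 2 y x p.1 : ℂˣ) : ℂ) * ξ p.2)) +
          finrank ℂ ↥(⨅ m, Module.End.maxGenEigenspace
            (Representation.normalizedJacquetGL F (lastBlockLabel 2) (Representation.parabolicIndGL F (lastBlockLabel 2)
              ((Representation.trivial ℂ (Π a : Bool, GL {i : Fin 2 // lastBlockLabel 2 i = a} F) ℂ).twist (maxParabolicLeviChar F 2 x y))) m)
            ((maxParabolicLeviChar F 2 x y m : ℂˣ) : ℂ)) := by
  classical
  -- (1) a non-zero `T₂ × D`-eigenfunctional of eigencharacter `(x ⊠ y) ⊗ ξ`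
  obtain ⟨l, hl0, hl⟩ := exists_functional_of_weightSpace_ne_bot τ (commute_prodRep hD τ)
    (fun p => ((maxParabolicLeviChar F 2 x y p.1 : ℂˣ) : ℂ) * ξ p.2) hne
  obtain ⟨v₀, hz₀⟩ : ∃ v, l (Representation.Coinvariants.mk (Representation.restrictUnipotentGL F (lastBlockLabel 2) W) v) ≠ 0 := by
    by_contra h
    push Not at h
    exact hl0 (Representation.Coinvariants.hom_ext (LinearMap.ext fun v => by rw [LinearMap.comp_apply, h v]; rfl))
  -- `ξ` is a character on the nose
  have hlD : ∀ d z, l (τ (1, d) z) = ξ d * l z := by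
    intro d z
    have h := hl (1, d) z
    simp only [map_one, Units.val_one, one_mul] at h
    exact h
  have hξ1 : ξ 1 = 1 := by
    have h := hlD 1 (Representation.Coinvariants.mk (Representation.restrictUnipotentGL F (lastBlockLabel 2) W) v₀)
    rw [Prod.mk_one_one, map_one, Module.End.one_apply] at h
    exact (mul_eq_right₀ hz₀).1 h.symm
  have hξmul : ∀ d d', ξ (d * d') = ξ d * ξ d' := by
    intro d d'
    have h := hlD (d * d') (Representation.Coinvariants.mk (Representation.restrictUnipotentGL F (lastBlockLabel 2) W) v₀)
    have h2 : τ ((1 : Π a : Bool, GL {i : Fin 2 // lastBlockLabel 2 i = a} F), d * d') (Representation.Coinvariants.mk (Representation.restrictUnipotentGL F (lastBlockLabel 2) W) v₀) =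
        τ ((1 : Π a : Bool, GL {i : Fin 2 // lastBlockLabel 2 i = a} F), d) (τ ((1 : Π a : Bool, GL {i : Fin 2 // lastBlockLabel 2 i = a} F), d')
          (Representation.Coinvariants.mk (Representation.restrictUnipotentGL F (lastBlockLabel 2) W) v₀)) := by
      rw [← Module.End.mul_apply, ← map_mul, Prod.mk_mul_mk, one_mul]
    rw [h2, hlD, hlD, ← mul_assoc] at h
    exact (mul_left_injective₀ hz₀ h).symm
  have hξ0 : ∀ d, ξ d ≠ 0 := by
    intro d h
    have h1 := hξmul d d⁻¹
    rw [mul_inv_cancel, hξ1, h, zero_mul] at h1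
    exact one_ne_zero h1
  -- (2) the `T₂`-map `r(W) → x ⊠ y` and the Frobenius map `Φ : W → I₂ x y`
  have hlT : ∀ t z, l (Representation.normalizedJacquetGL F (lastBlockLabel 2) W t z) = ((maxParabolicLeviChar F 2 x y t : ℂˣ) : ℂ) * l z := by
    intro t z
    have h := hl (t, 1) z
    rw [hτ₁, hξ1, mul_one] at h
    exact h
  let ψ : (Representation.normalizedJacquetGL F (lastBlockLabel 2) W).IntertwiningMap
      ((Representation.trivial ℂ (Π a : Bool, GL {i : Fin 2 // lastBlockLabel 2 i = a} F) ℂ).twist (maxParabolicLeviChar F 2 x y)) :=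
    ⟨l, fun t => LinearMap.ext fun z => by
      rw [LinearMap.comp_apply, LinearMap.comp_apply, Representation.twist_apply, Representation.trivial_apply, smul_eq_mul]
      exact hlT t z⟩
  have hΦ' : ∃ Φ : W.IntertwiningMap (Representation.parabolicIndGL F (lastBlockLabel 2)
      ((Representation.trivial ℂ (Π a : Bool, GL {i : Fin 2 // lastBlockLabel 2 i = a} F) ℂ).twist (maxParabolicLeviChar F 2 x y))),
      ∀ v g, (Φ v).toFun g = l (Representation.Coinvariants.mk (Representation.restrictUnipotentGL F (lastBlockLabel 2) W) (W g v)) := by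
    refine ⟨Representation.frobeniusInv hW
      { toLinearMap := ψ.toLinearMap ∘ₗ Representation.Coinvariants.mk (Representation.restrictUnipotentGL F (lastBlockLabel 2) W)
        isIntertwining' := fun q => LinearMap.ext fun v => by
          simp only [LinearMap.coe_comp, Function.comp_apply, Representation.IntertwiningMap.coe_toLinearMap]
          rw [Representation.twist_apply, MonoidHom.comp_apply, MonoidHom.comp_apply]
          exact apply_mk_apply_of_intertwining ψ q v }, fun v g => rfl⟩
  obtain ⟨Φ, hΦ⟩ := hΦ'
  -- `Φ ≠ 0`
  have hΦ1 : (Φ v₀).toFun 1 = l (Representation.Coinvariants.mk (Representation.restrictUnipotentGL F (lastBlockLabel 2) W) v₀) := by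
    rw [hΦ, W.map_one, Module.End.one_apply]
  have hΦv₀ : Φ v₀ ≠ 0 := by
    intro h
    have h2 : Φ v₀ = (0 : ℂ) • Φ v₀ := by rw [h, smul_zero]
    have h1 : (Φ v₀).toFun 1 = 0 := by
      rw [h2, Representation.SmoothInd.toFun_smul, Pi.smul_apply, smul_eq_mul, zero_mul]
    exact hz₀ (hΦ1.symm.trans h1)
  -- `Φ ∘ ζ(d) = ξ(d) Φ`
  have hΦD : ∀ d v, Φ (ζ d v) = ξ d • Φ v := by
    intro d v
    refine Representation.SmoothInd.ext (funext fun g => ?_)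
    rw [Representation.SmoothInd.toFun_smul, Pi.smul_apply, hΦ, hΦ, smul_eq_mul, ← Module.End.mul_apply, hWζ, Module.End.mul_apply, ← hτ₂, hlD]
  -- `Φ` is surjective
  have hΦG : ∀ g v, Φ (W g v) = (Representation.parabolicIndGL F (lastBlockLabel 2)
      ((Representation.trivial ℂ (Π a : Bool, GL {i : Fin 2 // lastBlockLabel 2 i = a} F) ℂ).twist (maxParabolicLeviChar F 2 x y))) g (Φ v) :=
    fun g v => Φ.isIntertwining _ _ g v
  have hsurj : Function.Surjective Φ := by
    have htop : Φ.range = ⊤ := by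
      rcases hirr.eq_bot_or_eq_top Φ.range with h | h
      · exfalso
        apply hΦv₀
        have hm : Φ v₀ ∈ Φ.range := (Representation.IntertwiningMap.mem_range _ _ Φ _).2 ⟨v₀, rfl⟩
        rw [h] at hm
        exact (Submodule.mem_bot ℂ).1 hm
      · exact h
    intro w
    have hw : w ∈ Φ.range := by rw [htop]; trivial
    exact (Representation.IntertwiningMap.mem_range _ _ Φ w).1 hw
  -- (3) the kernel, a `W`- and `ζ`-stable subspace, with its restricted actions
  have hK' : ∃ K : Subrepresentation W, ∀ v, v ∈ K ↔ Φ v = 0 :=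
    ⟨Φ.ker, fun v => Representation.IntertwiningMap.mem_ker _ _ Φ v⟩
  obtain ⟨K, hKmem⟩ := hK'
  have hKζ : ∀ d, ∀ v ∈ K, ζ d v ∈ K := fun d v hv =>
    (hKmem _).2 (by rw [hΦD, (hKmem v).1 hv, smul_zero])
  have hζK' : ∃ ζK : Representation ℂ D K.toSubmodule, ∀ d (v : K.toSubmodule), ((ζK d v : K.toSubmodule) : X) = ζ d (v : X) :=
    ⟨({ toSubmodule := K.toSubmodule, apply_mem_toSubmodule := fun d v hv => hKζ d v hv } : Subrepresentation ζ).toRepresentation, fun d v => rfl⟩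
  obtain ⟨ζK, hζK⟩ := hζK'
  have hWζK : ∀ g d, K.toRepresentation g * ζK d = ζK d * K.toRepresentation g := by
    intro g d
    refine LinearMap.ext fun v => Subtype.ext ?_
    change ((K.toRepresentation g (ζK d v) : K.toSubmodule) : X) = ((ζK d (K.toRepresentation g v) : K.toSubmodule) : X)
    rw [hζK]
    change W g ((ζK d v : K.toSubmodule) : X) = ζ d (W g (v : X))
    rw [hζK, ← Module.End.mul_apply, hWζ, Module.End.mul_apply]
  have hKsm : K.toRepresentation.IsSmooth := by
    intro v
    have h : (Representation.stabilizerSubgroup K.toRepresentation v : Set (GL (Fin 2) F)) = (Representation.stabilizerSubgroup W (v : X) : Set (GL (Fin 2) F)) := by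
      ext g
      simp only [SetLike.mem_coe, Representation.mem_stabilizerSubgroup]
      exact Subtype.ext_iff
    show IsOpen _
    rw [h]
    exact hW (v : X)
  -- the Jacquet maps: `C(K) → C(X)` injective, `C(X) → C(I₂ x y)` surjective, exact in the middle
  have hιK' : ∃ ιK : Representation.IntertwiningMap K.toRepresentation W, ∀ v, ιK v = (v : X) :=
    ⟨⟨K.toSubmodule.subtype, fun g => rfl⟩, fun v => rfl⟩
  obtain ⟨ιK, hιK⟩ := hιK'
  have hιK_inj : Function.Injective ιK := fun a b h => Subtype.ext (by rw [← hιK a, ← hιK b]; exact h)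
  have hjK' := exists_jacquetLinearMap K.toRepresentation W hW ιK
  obtain ⟨jK, hjK_mk, _hjK_J, hjK_inj, _hjK_surj⟩ := hjK'
  have hjK_inj' : Function.Injective jK := hjK_inj hιK_inj
  have hIsm : (Representation.parabolicIndGL F (lastBlockLabel 2)
      ((Representation.trivial ℂ (Π a : Bool, GL {i : Fin 2 // lastBlockLabel 2 i = a} F) ℂ).twist (maxParabolicLeviChar F 2 x y))).IsSmooth := by
    rw [parabolicIndGL_two_eq_smoothIndRep]; exact Representation.isSmooth_smoothInd _ _
  have hjΦ' := exists_jacquetLinearMap W (Representation.parabolicIndGL F (lastBlockLabel 2)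
    ((Representation.trivial ℂ (Π a : Bool, GL {i : Fin 2 // lastBlockLabel 2 i = a} F) ℂ).twist (maxParabolicLeviChar F 2 x y))) hIsm Φ
  obtain ⟨jΦ, hjΦ_mk, _hjΦ_J, _hjΦ_inj, hjΦ_surj⟩ := hjΦ'
  have hjΦ_surj' : Function.Surjective jΦ := hjΦ_surj hsurj
  have hΦU' : ∃ ΦU : (Representation.restrictUnipotentGL F (lastBlockLabel 2) W).IntertwiningMap (Representation.restrictUnipotentGL F (lastBlockLabel 2)
      (Representation.parabolicIndGL F (lastBlockLabel 2)
        ((Representation.trivial ℂ (Π a : Bool, GL {i : Fin 2 // lastBlockLabel 2 i = a} F) ℂ).twist (maxParabolicLeviChar F 2 x y)))), ∀ v, ΦU v = Φ v :=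
    ⟨⟨Φ.toLinearMap, fun u => Φ.isIntertwining' _⟩, fun v => rfl⟩
  obtain ⟨ΦU, hΦU⟩ := hΦU'
  have hexKΦ : Function.Exact ιK.toLinearMap ΦU := by
    intro v
    constructor
    · intro hv
      rw [hΦU] at hv
      exact ⟨⟨v, (hKmem v).2 hv⟩, hιK _⟩
    · rintro ⟨w, rfl⟩
      rw [Representation.IntertwiningMap.toLinearMap_apply, hιK, hΦU]
      exact (hKmem _).1 w.2
  have hsurjU : Function.Surjective ΦU := fun w => (hsurj w).imp fun v hv => (hΦU v).trans hv
  have hjΦ_mkU : ∀ v, jΦ (Representation.Coinvariants.mk _ v) = Representation.Coinvariants.mk _ (ΦU v) := fun v => by rw [hjΦ_mk, hΦU]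
  have hexact : Function.Exact jK jΦ :=
    exact_of_mk_comp (Representation.restrictUnipotentGL F (lastBlockLabel 2) K.toRepresentation) (Representation.restrictUnipotentGL F (lastBlockLabel 2) W)
      (Representation.restrictUnipotentGL F (lastBlockLabel 2) (Representation.parabolicIndGL F (lastBlockLabel 2)
        ((Representation.trivial ℂ (Π a : Bool, GL {i : Fin 2 // lastBlockLabel 2 i = a} F) ℂ).twist (maxParabolicLeviChar F 2 x y))))
      ιK.toLinearMap ΦU hexKΦ hsurjU jK jΦ hjK_mk hjΦ_mkU
  -- (4) the `T₂ × D`-modules: on `C(K)` (§1) and on `C(I₂ x y)` (`ξ(d) • r(t)`)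
  obtain ⟨τK, hτK₁, hτK₂⟩ := exists_prodRep K.toRepresentation ζK hWζK
  have hτ₃' : ∃ τ₃ : Representation ℂ ((Π a : Bool, GL {i : Fin 2 // lastBlockLabel 2 i = a} F) × D)
      (Representation.restrictUnipotentGL F (lastBlockLabel 2) (Representation.parabolicIndGL F (lastBlockLabel 2)
        ((Representation.trivial ℂ (Π a : Bool, GL {i : Fin 2 // lastBlockLabel 2 i = a} F) ℂ).twist (maxParabolicLeviChar F 2 x y)))).Coinvariants,
      ∀ p, τ₃ p = ξ p.2 • Representation.normalizedJacquetGL F (lastBlockLabel 2) (Representation.parabolicIndGL F (lastBlockLabel 2)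
        ((Representation.trivial ℂ (Π a : Bool, GL {i : Fin 2 // lastBlockLabel 2 i = a} F) ℂ).twist (maxParabolicLeviChar F 2 x y))) p.1 :=
    ⟨{ toFun := fun p => ξ p.2 • Representation.normalizedJacquetGL F (lastBlockLabel 2) (Representation.parabolicIndGL F (lastBlockLabel 2)
          ((Representation.trivial ℂ (Π a : Bool, GL {i : Fin 2 // lastBlockLabel 2 i = a} F) ℂ).twist (maxParabolicLeviChar F 2 x y))) p.1
       map_one' := by simp only [Prod.snd_one, Prod.fst_one, hξ1, map_one, one_smul]
       map_mul' := fun p q => by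
         simp only [Prod.snd_mul, Prod.fst_mul, hξmul, map_mul]
         exact (smul_mul_smul_comm _ _ _ _).symm }, fun p => rfl⟩
  obtain ⟨τ₃, hτ₃⟩ := hτ₃'
  -- equivariance of the two Jacquet maps for the `T₂ × D`-actions
  have hf : ∀ p c, jK (τK p c) = τ p (jK c) := by
    rintro ⟨t, d⟩ c
    refine Representation.Coinvariants.induction_on c fun w => ?_
    have e1 := prodRep_apply_mk K.toRepresentation ζK τK hτK₁ hτK₂ t d w
    have e2 := prodRep_apply_mk W ζ τ hτ₁ hτ₂ t d (w : X)
    have e3 : ((K.toRepresentation (blockDiagonalGL F (lastBlockLabel 2) t) (ζK d w) : K.toSubmodule) : X) = W (blockDiagonalGL F (lastBlockLabel 2) t) (ζ d (w : X)) := by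
      rw [← hζK d w]
      rfl
    have hmk1 : jK (Representation.Coinvariants.mk (Representation.restrictUnipotentGL F (lastBlockLabel 2) K.toRepresentation) w) =
        Representation.Coinvariants.mk (Representation.restrictUnipotentGL F (lastBlockLabel 2) W) (w : X) := by
      rw [hjK_mk, hιK]
    have hmk2 : jK (Representation.Coinvariants.mk (Representation.restrictUnipotentGL F (lastBlockLabel 2) K.toRepresentation)
          (K.toRepresentation (blockDiagonalGL F (lastBlockLabel 2) t) (ζK d w))) =
        Representation.Coinvariants.mk (Representation.restrictUnipotentGL F (lastBlockLabel 2) W) (W (blockDiagonalGL F (lastBlockLabel 2) t) (ζ d (w : X))) := by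
      rw [hjK_mk, hιK, e3]
    refine (congrArg jK e1).trans ?_
    refine (jK.map_smul _ _).trans ?_
    rw [hmk2, hmk1]
    exact e2.symm
  have hg : ∀ p c, jΦ (τ p c) = τ₃ p (jΦ c) := by
    rintro ⟨t, d⟩ c
    refine Representation.Coinvariants.induction_on c fun w => ?_
    have e2 := prodRep_apply_mk W ζ τ hτ₁ hτ₂ t d w
    have e4 : Φ (W (blockDiagonalGL F (lastBlockLabel 2) t) (ζ d w)) = ξ d • (Representation.parabolicIndGL F (lastBlockLabel 2)
        ((Representation.trivial ℂ (Π a : Bool, GL {i : Fin 2 // lastBlockLabel 2 i = a} F) ℂ).twist (maxParabolicLeviChar F 2 x y))) (blockDiagonalGL F (lastBlockLabel 2) t) (Φ w) :=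
      (hΦG _ _).trans ((congrArg _ (hΦD d w)).trans (LinearMap.map_smul _ _ _))
    have hmk3 : jΦ (Representation.Coinvariants.mk (Representation.restrictUnipotentGL F (lastBlockLabel 2) W) (W (blockDiagonalGL F (lastBlockLabel 2) t) (ζ d w))) =
        ξ d • Representation.Coinvariants.mk (Representation.restrictUnipotentGL F (lastBlockLabel 2) (Representation.parabolicIndGL F (lastBlockLabel 2)
          ((Representation.trivial ℂ (Π a : Bool, GL {i : Fin 2 // lastBlockLabel 2 i = a} F) ℂ).twist (maxParabolicLeviChar F 2 x y))))
          ((Representation.parabolicIndGL F (lastBlockLabel 2)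
            ((Representation.trivial ℂ (Π a : Bool, GL {i : Fin 2 // lastBlockLabel 2 i = a} F) ℂ).twist (maxParabolicLeviChar F 2 x y))) (blockDiagonalGL F (lastBlockLabel 2) t) (Φ w)) := by
      rw [hjΦ_mk, e4, LinearMap.map_smul]
    have hmk4 : jΦ (Representation.Coinvariants.mk (Representation.restrictUnipotentGL F (lastBlockLabel 2) W) w) =
        Representation.Coinvariants.mk (Representation.restrictUnipotentGL F (lastBlockLabel 2) (Representation.parabolicIndGL F (lastBlockLabel 2)
          ((Representation.trivial ℂ (Π a : Bool, GL {i : Fin 2 // lastBlockLabel 2 i = a} F) ℂ).twist (maxParabolicLeviChar F 2 x y)))) (Φ w) := hjΦ_mk w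
    have e5 := Representation.normalizedJacquetGL_mk F (lastBlockLabel 2) (Representation.parabolicIndGL F (lastBlockLabel 2)
      ((Representation.trivial ℂ (Π a : Bool, GL {i : Fin 2 // lastBlockLabel 2 i = a} F) ℂ).twist (maxParabolicLeviChar F 2 x y))) t (Φ w)
    refine (congrArg jΦ e2).trans ?_
    refine (jΦ.map_smul _ _).trans ?_
    rw [hmk3, hmk4, hτ₃, LinearMap.smul_apply, e5]
    exact smul_comm _ _ _
  -- (5) additivity of multiplicities (★ E1a)
  haveI hfdK : FiniteDimensional ℂ (Representation.restrictUnipotentGL F (lastBlockLabel 2) K.toRepresentation).Coinvariants := Module.Finite.of_injective jK hjK_inj'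
  haveI := finiteDimensional_jacquet_parabolicIndGL x y hx hy
  have hadd := fun η => finrank_weightSpace_eq_add_of_exact τK τ τ₃ (commute_prodRep hD τ) (commute_prodRep hD τ₃) jK jΦ hf hg hjK_inj' hexact hjΦ_surj' η
  -- the weights of `τ₃`
  have hkey : ∀ (u v : Fˣ →* ℂˣ), (⨅ p, Module.End.maxGenEigenspace (τ₃ p) (((maxParabolicLeviChar F 2 u v p.1 : ℂˣ) : ℂ) * ξ p.2)) =
      ⨅ m, Module.End.maxGenEigenspace (Representation.normalizedJacquetGL F (lastBlockLabel 2) (Representation.parabolicIndGL F (lastBlockLabel 2)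
        ((Representation.trivial ℂ (Π a : Bool, GL {i : Fin 2 // lastBlockLabel 2 i = a} F) ℂ).twist (maxParabolicLeviChar F 2 x y))) m)
        ((maxParabolicLeviChar F 2 u v m : ℂˣ) : ℂ) := by
    intro u v
    have hp : ∀ p : (Π a : Bool, GL {i : Fin 2 // lastBlockLabel 2 i = a} F) × D, Module.End.maxGenEigenspace (τ₃ p) (((maxParabolicLeviChar F 2 u v p.1 : ℂˣ) : ℂ) * ξ p.2) =
        Module.End.maxGenEigenspace (Representation.normalizedJacquetGL F (lastBlockLabel 2) (Representation.parabolicIndGL F (lastBlockLabel 2)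
          ((Representation.trivial ℂ (Π a : Bool, GL {i : Fin 2 // lastBlockLabel 2 i = a} F) ℂ).twist (maxParabolicLeviChar F 2 x y))) p.1)
          ((maxParabolicLeviChar F 2 u v p.1 : ℂˣ) : ℂ) := by
      intro p
      rw [hτ₃, maxGenEigenspace_smul_eq _ (hξ0 p.2), mul_comm _ (ξ p.2), inv_mul_cancel_left₀ (hξ0 p.2)]
    refine le_antisymm (le_iInf fun m => ?_) (le_iInf fun p => ?_)
    · rw [← hp (m, 1)]
      exact iInf_le _ _
    · rw [hp p]
      exact iInf_le _ _
  have hswap : finrank ℂ ↥(⨅ m, Module.End.maxGenEigenspace (Representation.normalizedJacquetGL F (lastBlockLabel 2) (Representation.parabolicIndGL F (lastBlockLabel 2)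
        ((Representation.trivial ℂ (Π a : Bool, GL {i : Fin 2 // lastBlockLabel 2 i = a} F) ℂ).twist (maxParabolicLeviChar F 2 x y))) m)
        ((maxParabolicLeviChar F 2 y x m : ℂˣ) : ℂ)) =
      finrank ℂ ↥(⨅ m, Module.End.maxGenEigenspace (Representation.normalizedJacquetGL F (lastBlockLabel 2) (Representation.parabolicIndGL F (lastBlockLabel 2)
        ((Representation.trivial ℂ (Π a : Bool, GL {i : Fin 2 // lastBlockLabel 2 i = a} F) ℂ).twist (maxParabolicLeviChar F 2 x y))) m)
        ((maxParabolicLeviChar F 2 x y m : ℂˣ) : ℂ)) := by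
    rw [finrank_weightSpace_parabolicIndGL x y hx hy (maxParabolicLeviChar F 2 y x), finrank_weightSpace_parabolicIndGL x y hx hy (maxParabolicLeviChar F 2 x y),
      if_pos rfl, if_pos rfl, add_comm]
    congr 1
    exact if_congr eq_comm rfl rfl
  -- (6) assemble
  refine ⟨K, ζK, τK, hζK, hWζK, hKsm, hτK₁, hτK₂, hfdK, ?_, ?_, ?_⟩
  · -- `finrank C(K) + 2 = finrank C(X)`
    have hrn := LinearMap.finrank_range_add_finrank_ker jΦ
    rw [LinearMap.range_eq_top.2 hjΦ_surj', finrank_top, finrank_jacquet_parabolicIndGL x y hx hy] at hrn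
    have hker : finrank ℂ ↥(LinearMap.ker jΦ) = finrank ℂ (Representation.restrictUnipotentGL F (lastBlockLabel 2) K.toRepresentation).Coinvariants := by
      rw [LinearMap.exact_iff.1 hexact]
      exact (LinearEquiv.finrank_eq (LinearEquiv.ofInjective jK hjK_inj')).symm
    omega
  · rw [hadd, hkey x y]
  · rw [hadd, hkey y x, hswap]

end Peel

end Summit.HodgeConjecture.HodgeConjecture.Cruxes.H413.K2E3GL2JacquetPeelingStep

end
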